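import Literature.Analysis.FluidPDE.ExtremeGrowthVorticityControl
import Literature.Analysis.FunctionSpaces.TorusEnstrophyOrthogonality
import Mathlib.Algebra.Order.Chebyshev
import HarnessLib

/-!
# Discharge of `DoeringGibbon1995_enstrophyRate_le_vorticitySup`: `dℰ/dt ≤ 2‖ω‖_∞ ℰ` on `T³` — PROVED

Analysis/FluidPDE proof file (theorems only: no definitions, no named facts), sibling of
`ExtremeGrowthVorticityControl.lean`, whose NAMED FACT
`Literature.Analysis.FluidPDE.DoeringGibbon1995_enstrophyRate_le_vorticitySup` (Doering–Gibbon 1995,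
eq. (6.5.18): along a classical solution of the unforced Navier–Stokes/Euler equations on the unit
3-torus, every one-sided derivative value `R` of `t ↦ ℰ(u t) = ½‖∇u‖₂²` obeys `R ≤ 2Mℰ(u t)`
whenever `|ω(t,·)|² ≤ M²` pointwise) it DISCHARGES:
`DoeringGibbon1995_enstrophyRate_le_vorticitySup_holds`. This is the kernel-checked form of the
enstrophy/`‖ω‖_∞` yardstick used by the extreme-growth and functional-mining cells
(pub-fluidc BOUNDS §3.6; pub-nsfunc EXTREME-GROWTH.md G6).

## The argument (Doering–Gibbon 1995, §6.5, with Betchov's identity making the pointwise step honest)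

1. `H¹` balance (tree, `Torus.IsClassicalNSSolutionOn.hasDerivWithinAt_half_gradNormSq`):
   `R = -ν‖Δu‖₂² + ∫ ⟪(u·∇)u, Δu⟫ ≤ ∫ ⟪(u·∇)u, Δu⟫` (`ν ≥ 0`).
2. Orthogonality form (tree, `Torus.integral_inner_laplacian_convect_self_eq_neg`):
   `∫ ⟪Δu, (u·∇)u⟫ = -∫ C`, `C = ∑ₘᵢ (∂ₘu)ᵢ ⟪∂ₘu, ∂ᵢu⟫ = tr (G Gᵀ G)`, `Gᵢⱼ = ∂ⱼuᵢ`.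
3. **Betchov's identity** (proved here, `integral_sum_partialDeriv_cube_eq_zero`): `∫ tr (G³) = 0`
   for smooth divergence-free periodic `u` — two integrations by parts: `∑ⱼ ∂ⱼuᵢ ∂ₖuⱼ =
   ∑ⱼ ∂ⱼ(uᵢ ∂ₖuⱼ)` (the remainder is `uᵢ ∂ₖ div u = 0`), then
   `∑ uᵢ ∂ₖuⱼ ∂ⱼ∂ᵢuₖ = ½ (u·∇) tr (G²)` integrates to zero by the transport identity.
   Hence `∫ ⟪(u·∇)u, Δu⟫ = ∫ (tr G³ - tr GGᵀG)`.
4. **Pointwise algebra** (`DoeringGibbon1995.cubeTrace_sub_stretchCubic`, a `ring` identity in the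
   nine entries): `tr G³ - tr GGᵀG = ωᵀSω - |ω|² tr G`, `S = ½(G + Gᵀ)`,
   `ω = (G₂₁-G₁₂, G₀₂-G₂₀, G₁₀-G₀₁)`; with `tr G = div u = 0` the integrand is the vortex-stretching
   density `ωᵀSω`, and by Cauchy–Schwarz `|ωᵀSω| ≤ |S|_F |ω|² ≤ M |S|_F |ω| ≤ M |G|_F²`
   (`|S|_F² · |ω|² = 2|S|_F²|A|_F² ≤ (|S|_F² + |A|_F²)² = |G|_F⁴`). NB the cruder
   `|tr(SA²)| ≤ |S|_F|A|_F²` would lose a factor `2` against the printed constant.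
5. Integrate: `R ≤ M ∫ |∇u|² = M‖∇u‖₂² = 2Mℰ`.

The general index type `d` with `Fintype.card d = 3` is transported to `Fin 3` pointwise
(`Fintype.equivFinOfCardEq`).

## Mathlib / tree search

Tree (used): `Torus.IsClassicalNSSolutionOn.hasDerivWithinAt_half_gradNormSq`
(`TorusClassicalH1Balance`), `Torus.integral_inner_laplacian_convect_self_eq_neg`,
`Torus.partialDeriv_apply_coord`, `Torus.partialDeriv_comm`, `Torus.partialDeriv_finset_sum`,
`Torus.divergence_eq_sum_partialDeriv_apply`, `Torus.isSmooth_sum_norm_sq_partialDeriv`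
(`TorusEnstrophyOrthogonality`), `Torus.integral_inner_partialDeriv_eq_neg` (`TorusFluidGlueProofs`),
`Torus.partialDeriv_mul`, `Torus.fderiv_apply_eq_sum_partialDeriv`,
`Torus.integral_fderiv_apply_eq_zero_of_isDivFree` (`TorusCalculusProofs`), `torusVorticitySqAt`,
`torusEnstrophy`, `gradNormSq_eq_two_mul_torusEnstrophy` (`ExtremeGrowth*`). Mathlib:
`Finset.sum_mul_sq_le_sq_mul_sq` (Cauchy–Schwarz), `abs_le_of_sq_le_sq'`, `HasDerivWithinAt.derivWithin`,
`uniqueDiffOn_Icc`. `lean search 'Betchov|cubeTrace|trace_cube'`: nothing in the tree (the 2D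
vanishing `sum_partialDeriv_mul_inner_eq_zero_of_fin_two` is the only relative).

## References

* C. R. Doering, J. D. Gibbon, *Applied Analysis of the Navier–Stokes Equations*, CUP 1995, §6.5
  eq. (6.5.18). [DoeringGibbon1995]
* R. Betchov, *An inequality concerning the production of vorticity in isotropic turbulence*,
  J. Fluid Mech. 1 (1956) 497–504 (the identities `⟨tr G²⟩ = ⟨tr G³⟩ = 0` for homogeneous
  incompressible fields; used here in the periodic form, proved directly). [folklore]
* A. J. Majda, A. L. Bertozzi, *Vorticity and Incompressible Flow*, CUP 2002, §1.4 (1.31).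
  [MajdaBertozziCUP2002]
-/

noncomputable section

open Set MeasureTheory Finset
open scoped InnerProductSpace RealInnerProductSpace

namespace Literature.Analysis.FluidPDE

open Literature.Analysis.FunctionSpaces

/-! ### Pointwise algebra on `3 × 3` arrays -/

namespace DoeringGibbon1995

/-- `tr G³ - tr GGᵀG = ωᵀSω - |ω|² tr G` for a `3 × 3` array `G`, its vorticity vector
`ω = (G₂₁ - G₁₂, G₀₂ - G₂₀, G₁₀ - G₀₁)` (Majda–Bertozzi 2002, (1.31), `Gᵢⱼ = ∂ⱼuᵢ`) and symmetric
part `S = ½(G + Gᵀ)` — a polynomial identity in the nine entries. [folklore] -/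
theorem cubeTrace_sub_stretchCubic (G : Fin 3 → Fin 3 → ℝ) (w : Fin 3 → ℝ)
    (hw : w = ![G 2 1 - G 1 2, G 0 2 - G 2 0, G 1 0 - G 0 1]) :
    (∑ i, ∑ j, ∑ k, G i j * G j k * G k i) - (∑ i, ∑ j, ∑ m, G i m * G j m * G j i) =
      (∑ i, ∑ j, w i * ((G i j + G j i) / 2) * w j) - (∑ i, w i ^ 2) * (∑ i, G i i) := by
  subst hw
  simp only [Fin.sum_univ_three, Matrix.cons_val_zero, Matrix.cons_val_one, Matrix.head_cons,
    Matrix.cons_val_two, Matrix.tail_cons]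
  ring

/-- `|ω|² = ½ ∑ᵢⱼ (Gᵢⱼ - Gⱼᵢ)²`. [folklore] -/
theorem sum_vort_sq (G : Fin 3 → Fin 3 → ℝ) (w : Fin 3 → ℝ)
    (hw : w = ![G 2 1 - G 1 2, G 0 2 - G 2 0, G 1 0 - G 0 1]) :
    ∑ i, w i ^ 2 = 2⁻¹ * ∑ i, ∑ j, (G i j - G j i) ^ 2 := by
  subst hw
  simp only [Fin.sum_univ_three, Matrix.cons_val_zero, Matrix.cons_val_one, Matrix.head_cons,
    Matrix.cons_val_two, Matrix.tail_cons]
  ring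

/-- `|S|_F² + |A|_F² = |G|_F²`. [folklore] -/
theorem sum_symm_sq_add (G : Fin 3 → Fin 3 → ℝ) :
    (∑ i, ∑ j, ((G i j + G j i) / 2) ^ 2) + 4⁻¹ * ∑ i, ∑ j, (G i j - G j i) ^ 2 =
      ∑ i, ∑ j, G i j ^ 2 := by
  simp only [Fin.sum_univ_three]
  ring

/-- Cauchy–Schwarz for the quadratic form: `(ωᵀSω)² ≤ |S|_F² |ω|⁴`. [folklore] -/
theorem quadForm_sq_le (S : Fin 3 → Fin 3 → ℝ) (w : Fin 3 → ℝ) :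
    (∑ i, ∑ j, w i * S i j * w j) ^ 2 ≤ (∑ i, ∑ j, S i j ^ 2) * (∑ i, w i ^ 2) ^ 2 := by
  have h := Finset.sum_mul_sq_le_sq_mul_sq (univ : Finset (Fin 3 × Fin 3))
    (fun p => S p.1 p.2) (fun p => w p.1 * w p.2)
  have h1 : ∑ p : Fin 3 × Fin 3, S p.1 p.2 * (w p.1 * w p.2) = ∑ i, ∑ j, w i * S i j * w j := by
    rw [Fintype.sum_prod_type]
    exact Finset.sum_congr rfl fun i _ => Finset.sum_congr rfl fun j _ => by ring
  have h2 : ∑ p : Fin 3 × Fin 3, (S p.1 p.2) ^ 2 = ∑ i, ∑ j, S i j ^ 2 := by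
    rw [Fintype.sum_prod_type]
  have h3 : ∑ p : Fin 3 × Fin 3, (w p.1 * w p.2) ^ 2 = (∑ i, w i ^ 2) ^ 2 := by
    rw [Fintype.sum_prod_type, sq, Finset.sum_mul_sum]
    exact Finset.sum_congr rfl fun i _ => Finset.sum_congr rfl fun j _ => by ring
  rw [h1, h2, h3] at h
  exact h

/-- **The pointwise stretching bound.** For a trace-free `3 × 3` array `G` whose vorticity vector
`ω` has `|ω|² ≤ M²`, `M ≥ 0`: `tr G³ - tr GGᵀG ≤ M ∑ᵢⱼ Gᵢⱼ²` (Doering–Gibbon 1995, the pointwise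
step `|ω·Sω| ≤ |ω|²|S|` of (6.5.18), combined with `|S|_F|ω| ≤ |G|_F²`).
[cite: DoeringGibbon1995, §6.5 eq. (6.5.18)] -/
theorem cubeTrace_sub_stretchCubic_le (G : Fin 3 → Fin 3 → ℝ) {M : ℝ} (hM : 0 ≤ M)
    (htr : ∑ i, G i i = 0) (w : Fin 3 → ℝ)
    (hw : w = ![G 2 1 - G 1 2, G 0 2 - G 2 0, G 1 0 - G 0 1]) (hω : ∑ i, w i ^ 2 ≤ M ^ 2) :
    (∑ i, ∑ j, ∑ k, G i j * G j k * G k i) - (∑ i, ∑ j, ∑ m, G i m * G j m * G j i) ≤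
      M * ∑ i, ∑ j, G i j ^ 2 := by
  set Q : ℝ := ∑ i, ∑ j, w i * ((G i j + G j i) / 2) * w j with hQ
  set x : ℝ := ∑ i, ∑ j, ((G i j + G j i) / 2) ^ 2 with hx
  set y : ℝ := 4⁻¹ * ∑ i, ∑ j, (G i j - G j i) ^ 2 with hy
  set wsq : ℝ := ∑ i, w i ^ 2 with hwsq
  set g : ℝ := ∑ i, ∑ j, G i j ^ 2 with hg
  have hid : (∑ i, ∑ j, ∑ k, G i j * G j k * G k i) - (∑ i, ∑ j, ∑ m, G i m * G j m * G j i) =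
      Q := by
    rw [cubeTrace_sub_stretchCubic G w hw, htr, mul_zero, sub_zero]
  have hxy : x + y = g := sum_symm_sq_add G
  have hw2y : wsq = 2 * y := by
    rw [hwsq, sum_vort_sq G w hw, hy]; ring
  have hx0 : 0 ≤ x := Finset.sum_nonneg fun i _ => Finset.sum_nonneg fun j _ => sq_nonneg _
  have hy0 : 0 ≤ y := mul_nonneg (by norm_num)
    (Finset.sum_nonneg fun i _ => Finset.sum_nonneg fun j _ => sq_nonneg _)
  have hg0 : 0 ≤ g := by rw [← hxy]; exact add_nonneg hx0 hy0
  have hw0 : 0 ≤ wsq := Finset.sum_nonneg fun i _ => sq_nonneg _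
  -- Cauchy–Schwarz: `Q² ≤ x · wsq²`
  have hCS : Q ^ 2 ≤ x * wsq ^ 2 := quadForm_sq_le (fun i j => (G i j + G j i) / 2) w
  -- `x · wsq ≤ g²`
  have hxw : x * wsq ≤ g ^ 2 := by
    rw [hw2y, ← hxy]; nlinarith [sq_nonneg (x - y)]
  -- hence `Q² ≤ (g M)²`
  have hQ2 : Q ^ 2 ≤ (g * M) ^ 2 := by
    calc Q ^ 2 ≤ x * wsq ^ 2 := hCS
      _ = (x * wsq) * wsq := by ring
      _ ≤ g ^ 2 * M ^ 2 := mul_le_mul hxw hω hw0 (sq_nonneg _)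
      _ = (g * M) ^ 2 := by ring
  have hQle : Q ≤ g * M := (abs_le_of_sq_le_sq' hQ2 (mul_nonneg hg0 hM)).2
  rw [hid]
  linarith [hQle]

end DoeringGibbon1995

/-! ### Betchov's identity on the torus -/

variable {d : Type*} [Fintype d] [DecidableEq d]

omit [Fintype d] in
/-- Partial derivatives of constants vanish. [folklore] -/
theorem DoeringGibbon1995.torus_partialDeriv_const (c : ℝ) (k : d) (x : UnitAddTorus d) :
    Torus.partialDeriv k (fun _ : UnitAddTorus d => c) x = 0 := by
  simp [Torus.partialDeriv, Torus.lineDeriv]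


/-- **Betchov's identity** `∫_{T^d} tr ((∇u)³) = 0` for a smooth divergence-free field:
`∫ ∑ᵢⱼₖ ∂ⱼuᵢ ∂ₖuⱼ ∂ᵢuₖ = 0`. [folklore] -/
theorem integral_sum_partialDeriv_cube_eq_zero {u : UnitAddTorus d → EuclideanSpace ℝ d}
    (hu : Torus.IsSmooth u) (hdiv : Torus.IsDivFree u) :
    ∫ x, ∑ i, ∑ j, ∑ k, Torus.partialDeriv j u x i * Torus.partialDeriv k u x j *
      Torus.partialDeriv i u x k = 0 := by
  have hu1 : Torus.IsContDiff 1 u := hu.isContDiff (by simp)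
  have hD : ∀ m, Torus.IsSmooth (Torus.partialDeriv m u) := fun m => hu.partialDeriv m
  have hD1 : ∀ m, Torus.IsContDiff 1 (Torus.partialDeriv m u) := fun m =>
    (hD m).isContDiff (by simp)
  have hDc : ∀ m j, Torus.IsSmooth (fun y => Torus.partialDeriv m u y j) := fun m j => (hD m).apply j
  have hDc1 : ∀ m j, Torus.IsContDiff 1 (fun y => Torus.partialDeriv m u y j) := fun m j =>
    (hDc m j).isContDiff (by simp)
  have huc : ∀ i, Torus.IsSmooth (fun y => u y i) := fun i => hu.apply i
  have huc1 : ∀ i, Torus.IsContDiff 1 (fun y => u y i) := fun i => (huc i).isContDiff (by simp)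
  -- `ψ i k j := uᵢ (∂ₖu)ⱼ` is smooth
  have hψ : ∀ i k j, Torus.IsSmooth (fun y => u y i * Torus.partialDeriv k u y j) := by
    intro i k j
    have h : Torus.IsSmooth (fun y => u y i * Torus.partialDeriv k u y j) := (huc i).mul (hDc k j)
    exact h
  -- second derivatives of coordinates: `∂ⱼ (∂ₘu)ₖ = ∂ₘ (∂ⱼu)ₖ`
  have hcomm : ∀ j m k x, Torus.partialDeriv j (fun y => Torus.partialDeriv m u y k) x =
      Torus.partialDeriv m (fun y => Torus.partialDeriv j u y k) x := by
    intro j m k x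
    rw [Torus.partialDeriv_apply_coord (hD1 m), Torus.partialDeriv_apply_coord (hD1 j),
      Torus.partialDeriv_comm hu j m x]
  -- Step A: `∑ⱼ (∂ⱼu)ᵢ (∂ₖu)ⱼ = ∑ⱼ ∂ⱼ(uᵢ (∂ₖu)ⱼ)` (the term `uᵢ ∂ₖ div u` vanishes)
  have hA : ∀ i k x, ∑ j, Torus.partialDeriv j u x i * Torus.partialDeriv k u x j =
      ∑ j, Torus.partialDeriv j (fun y => u y i * Torus.partialDeriv k u y j) x := by
    intro i k x
    have hprod : ∀ j, Torus.partialDeriv j (fun y => u y i * Torus.partialDeriv k u y j) x =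
        u x i * Torus.partialDeriv j (fun y => Torus.partialDeriv k u y j) x +
          Torus.partialDeriv j u x i * Torus.partialDeriv k u x j := by
      intro j
      rw [Torus.partialDeriv_mul (huc1 i) (hDc1 k j), Torus.partialDeriv_apply_coord hu1]
    have hvan : ∑ j, Torus.partialDeriv j (fun y => Torus.partialDeriv k u y j) x = 0 := by
      simp_rw [show ∀ j, Torus.partialDeriv j (fun y => Torus.partialDeriv k u y j) x =
          Torus.partialDeriv k (fun y => Torus.partialDeriv j u y j) x from fun j => hcomm j k j x]
      rw [← Torus.partialDeriv_finset_sum Finset.univ (fun j _ => hDc1 j j)]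
      have hdivfun : (fun y => ∑ j, Torus.partialDeriv j u y j) = fun _ => (0 : ℝ) := by
        funext y
        rw [← Torus.divergence_eq_sum_partialDeriv_apply hu1]
        exact hdiv y
      rw [hdivfun, DoeringGibbon1995.torus_partialDeriv_const]
    simp_rw [hprod]
    rw [Finset.sum_add_distrib, ← Finset.mul_sum, hvan, mul_zero, zero_add]
  -- `θ := ∑ⱼₖ (∂ₖu)ⱼ (∂ⱼu)ₖ = tr ((∇u)²)` and its derivative
  set θ : UnitAddTorus d → ℝ := fun y => ∑ j, ∑ k, Torus.partialDeriv k u y j *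
    Torus.partialDeriv j u y k with hθ_def
  have hθjk : ∀ j k, Torus.IsSmooth (fun y => Torus.partialDeriv k u y j *
      Torus.partialDeriv j u y k) := by
    intro j k
    have h : Torus.IsSmooth (fun y => Torus.partialDeriv k u y j * Torus.partialDeriv j u y k) :=
      (hDc k j).mul (hDc j k)
    exact h
  have hθ : Torus.IsSmooth θ := by
    have h := hθjk
    unfold Torus.IsSmooth at h ⊢
    exact ContDiff.sum fun j _ => ContDiff.sum fun k _ => h j k
  have hθ1 : Torus.IsContDiff 1 θ := hθ.isContDiff (by simp)
  -- Step C (pointwise): `∑ₖⱼ (∂ₖu)ⱼ ∂ⱼ((∂ᵢu)ₖ) = ½ ∂ᵢθ`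
  have hC : ∀ i x, ∑ k, ∑ j, Torus.partialDeriv k u x j *
      Torus.partialDeriv j (fun y => Torus.partialDeriv i u y k) x =
        2⁻¹ * Torus.partialDeriv i θ x := by
    intro i x
    have hθi : Torus.partialDeriv i θ x = ∑ j, ∑ k,
        (Torus.partialDeriv k u x j * Torus.partialDeriv i (fun y => Torus.partialDeriv j u y k) x +
          Torus.partialDeriv i (fun y => Torus.partialDeriv k u y j) x *
            Torus.partialDeriv j u x k) := by
      rw [hθ_def, Torus.partialDeriv_finset_sum Finset.univ (fun j _ => ?_)]
      · refine Finset.sum_congr rfl fun j _ => ?_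
        rw [Torus.partialDeriv_finset_sum Finset.univ (fun k _ => (hθjk j k).isContDiff (by simp))]
        refine Finset.sum_congr rfl fun k _ => ?_
        rw [Torus.partialDeriv_mul (hDc1 k j) (hDc1 j k)]
      · have h := fun k => hθjk j k
        have : Torus.IsSmooth (fun y => ∑ k, Torus.partialDeriv k u y j *
            Torus.partialDeriv j u y k) := by
          unfold Torus.IsSmooth at h ⊢
          exact ContDiff.sum fun k _ => h k
        exact this.isContDiff (by simp)
    -- the two halves of `∂ᵢθ` agree after renaming `j ↔ k`
    have hhalf : ∑ j, ∑ k, Torus.partialDeriv i (fun y => Torus.partialDeriv k u y j) x *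
        Torus.partialDeriv j u x k =
        ∑ j, ∑ k, Torus.partialDeriv k u x j *
          Torus.partialDeriv i (fun y => Torus.partialDeriv j u y k) x := by
      rw [Finset.sum_comm]
      exact Finset.sum_congr rfl fun j _ => Finset.sum_congr rfl fun k _ => by ring
    have hsplit : (∑ j, ∑ k,
        (Torus.partialDeriv k u x j * Torus.partialDeriv i (fun y => Torus.partialDeriv j u y k) x +
          Torus.partialDeriv i (fun y => Torus.partialDeriv k u y j) x *
            Torus.partialDeriv j u x k)) =
        (∑ j, ∑ k, Torus.partialDeriv k u x j *
          Torus.partialDeriv i (fun y => Torus.partialDeriv j u y k) x) +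
        ∑ j, ∑ k, Torus.partialDeriv i (fun y => Torus.partialDeriv k u y j) x *
          Torus.partialDeriv j u x k := by
      simp only [Finset.sum_add_distrib]
    have hlhs : ∑ k, ∑ j, Torus.partialDeriv k u x j *
        Torus.partialDeriv j (fun y => Torus.partialDeriv i u y k) x =
        ∑ j, ∑ k, Torus.partialDeriv k u x j *
          Torus.partialDeriv i (fun y => Torus.partialDeriv j u y k) x := by
      rw [Finset.sum_comm]
      exact Finset.sum_congr rfl fun j _ => Finset.sum_congr rfl fun k _ => by
        rw [hcomm j i k x]
    rw [hlhs, hθi, hsplit, hhalf]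
    ring
  -- Step B: integrate by parts
  have hint : ∫ x, ∑ i, ∑ j, ∑ k, Torus.partialDeriv j u x i * Torus.partialDeriv k u x j *
      Torus.partialDeriv i u x k =
      ∑ i, ∑ k, ∑ j, ∫ x, Torus.partialDeriv j (fun y => u y i * Torus.partialDeriv k u y j) x *
        Torus.partialDeriv i u x k := by
    have hpt : ∀ x, ∑ i, ∑ j, ∑ k, Torus.partialDeriv j u x i * Torus.partialDeriv k u x j *
        Torus.partialDeriv i u x k =
        ∑ i, ∑ k, ∑ j, Torus.partialDeriv j (fun y => u y i * Torus.partialDeriv k u y j) x *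
          Torus.partialDeriv i u x k := by
      intro x
      refine Finset.sum_congr rfl fun i _ => ?_
      rw [Finset.sum_comm]
      refine Finset.sum_congr rfl fun k _ => ?_
      rw [← Finset.sum_mul, ← Finset.sum_mul, hA i k x]
    simp_rw [hpt]
    have hterm : ∀ i k j, Integrable (fun x => Torus.partialDeriv j
        (fun y => u y i * Torus.partialDeriv k u y j) x * Torus.partialDeriv i u x k) := by
      intro i k j
      have h : Torus.IsSmooth (fun x => Torus.partialDeriv j
          (fun y => u y i * Torus.partialDeriv k u y j) x * Torus.partialDeriv i u x k) :=
        ((hψ i k j).partialDeriv j).mul (hDc i k)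
      exact h.integrable
    rw [integral_finsetSum _ fun i _ => ?_]
    · refine Finset.sum_congr rfl fun i _ => ?_
      rw [integral_finsetSum _ fun k _ => ?_]
      · refine Finset.sum_congr rfl fun k _ => ?_
        rw [integral_finsetSum _ fun j _ => hterm i k j]
      · exact integrable_finsetSum _ fun j _ => hterm i k j
    · exact integrable_finsetSum _ fun k _ => integrable_finsetSum _ fun j _ => hterm i k j
  have hibp : ∀ i k j, ∫ x, Torus.partialDeriv j (fun y => u y i * Torus.partialDeriv k u y j) x *
      Torus.partialDeriv i u x k =
      -∫ x, u x i * Torus.partialDeriv k u x j *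
        Torus.partialDeriv j (fun y => Torus.partialDeriv i u y k) x := by
    intro i k j
    have h := Torus.integral_inner_partialDeriv_eq_neg (G := ℝ) (hψ i k j) (hDc i k) j
    simp_rw [show ∀ a b : ℝ, ⟪a, b⟫_ℝ = a * b from fun a b => by simp [mul_comm]] at h
    exact h
  rw [hint]
  simp_rw [hibp]
  -- collect: `-∑ᵢₖⱼ ∫ uᵢ (∂ₖu)ⱼ ∂ⱼ(∂ᵢu)ₖ = -∫ ∑ᵢ uᵢ · ½ ∂ᵢθ = -½ ∫ Dθ[u] = 0`
  have hterm2 : ∀ i k j, Integrable (fun x => u x i * Torus.partialDeriv k u x j *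
      Torus.partialDeriv j (fun y => Torus.partialDeriv i u y k) x) := by
    intro i k j
    have h : Torus.IsSmooth (fun x => u x i * Torus.partialDeriv k u x j *
        Torus.partialDeriv j (fun y => Torus.partialDeriv i u y k) x) :=
      ((huc i).mul (hDc k j)).mul ((hDc i k).partialDeriv j)
    exact h.integrable
  have hcollect : ∑ i, ∑ k, ∑ j, -∫ x, u x i * Torus.partialDeriv k u x j *
      Torus.partialDeriv j (fun y => Torus.partialDeriv i u y k) x =
      -∫ x, ∑ i, u x i * (2⁻¹ * Torus.partialDeriv i θ x) := by
    simp_rw [← hC]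
    rw [integral_finsetSum _ fun i _ => ?_, ← Finset.sum_neg_distrib]
    · refine Finset.sum_congr rfl fun i _ => ?_
      simp_rw [Finset.mul_sum]
      rw [integral_finsetSum _ fun k _ => ?_, ← Finset.sum_neg_distrib]
      · refine Finset.sum_congr rfl fun k _ => ?_
        rw [integral_finsetSum _ fun j _ => ?_, ← Finset.sum_neg_distrib]
        · refine Finset.sum_congr rfl fun j _ => ?_
          congr 1
          refine integral_congr_ae (Filter.Eventually.of_forall fun x => ?_)
          ring
        · have := hterm2 i k j
          exact this.congr (Filter.Eventually.of_forall fun x => by ring)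
      · exact integrable_finsetSum _ fun j _ =>
          (hterm2 i k j).congr (Filter.Eventually.of_forall fun x => by ring)
    · simp_rw [Finset.mul_sum]
      exact integrable_finsetSum _ fun k _ => integrable_finsetSum _ fun j _ =>
        (hterm2 i k j).congr (Filter.Eventually.of_forall fun x => by ring)
  rw [hcollect]
  have htransport : ∫ x, ∑ i, u x i * (2⁻¹ * Torus.partialDeriv i θ x) =
      2⁻¹ * ∫ x, Torus.fderiv θ x (u x) := by
    rw [← integral_const_mul]
    refine integral_congr_ae (Filter.Eventually.of_forall fun x => ?_)
    simp only [Torus.fderiv_apply_eq_sum_partialDeriv hθ1, smul_eq_mul, Finset.mul_sum]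
    exact Finset.sum_congr rfl fun i _ => by ring
  rw [htransport, Torus.integral_fderiv_apply_eq_zero_of_isDivFree hu hθ hdiv, mul_zero, neg_zero]


/-! ### Transport to `Fin 3` and the discharge -/

/-- **Pointwise vortex-stretching bound on `T^d`, `card d = 3`.** For a smooth divergence-free
`v` with `|ω(x)|² = torusVorticitySqAt v x ≤ M²`, `M ≥ 0`, the density
`tr G³ - tr GGᵀG` (`Gᵢⱼ = (∂ⱼv)ᵢ`) is at most `M ∑ₘ ‖∂ₘv(x)‖²` (Doering–Gibbon 1995, pointwise step
of (6.5.18)). [cite: DoeringGibbon1995, §6.5 eq. (6.5.18)] -/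
theorem sum_partialDeriv_cube_sub_stretch_le (hd : Fintype.card d = 3)
    {v : UnitAddTorus d → EuclideanSpace ℝ d} (hv : Torus.IsSmooth v) (hdiv : Torus.IsDivFree v)
    {M : ℝ} (hM : 0 ≤ M) (x : UnitAddTorus d) (hω : torusVorticitySqAt v x ≤ M ^ 2) :
    (∑ i, ∑ j, ∑ k, Torus.partialDeriv j v x i * Torus.partialDeriv k v x j *
        Torus.partialDeriv i v x k) -
      (∑ m, ∑ i, Torus.partialDeriv m v x i *
        ⟪Torus.partialDeriv m v x, Torus.partialDeriv i v x⟫_ℝ) ≤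
      M * ∑ m, ‖Torus.partialDeriv m v x‖ ^ 2 := by
  set e : d ≃ Fin 3 := Fintype.equivFinOfCardEq hd with he
  set R : d → EuclideanSpace ℝ d := fun m => Torus.partialDeriv m v x with hR
  set G : Fin 3 → Fin 3 → ℝ := fun a b => R (e.symm b) (e.symm a) with hG
  have hre : ∀ F : d → ℝ, ∑ i, F i = ∑ a : Fin 3, F (e.symm a) := fun F =>
    Fintype.sum_equiv e _ _ fun i => by simp
  -- (i) the cubic trace
  have hB : ∑ i, ∑ j, ∑ k, R j i * R k j * R i k = ∑ a, ∑ b, ∑ c, G a b * G b c * G c a := by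
    simp only [hG]
    simp_rw [hre]
  -- (ii) the stretching cubic
  have hC : ∑ m, ∑ i, R m i * ⟪R m, R i⟫_ℝ = ∑ a, ∑ b, ∑ c, G a c * G b c * G b a := by
    have h1 : ∑ m, ∑ i, R m i * ⟪R m, R i⟫_ℝ = ∑ i, ∑ j, ∑ m, R m i * R m j * R i j := by
      have hinner : ∀ m i, R m i * ⟪R m, R i⟫_ℝ = ∑ j, R m i * R m j * R i j := by
        intro m i
        rw [show ⟪R m, R i⟫_ℝ = ∑ j, R m j * R i j from by simp [PiLp.inner_apply, mul_comm],
          Finset.mul_sum]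
        exact Finset.sum_congr rfl fun j _ => by ring
      simp_rw [hinner]
      rw [Finset.sum_comm]
      exact Finset.sum_congr rfl fun i _ => Finset.sum_comm
    rw [h1]
    simp only [hG]
    simp_rw [hre]
  -- (iii) the trace is the divergence
  have htr : ∑ a, G a a = 0 := by
    have h1 : ∑ a, G a a = ∑ m, R m m := by
      simp only [hG]; rw [hre]
    rw [h1, hR]
    have h2 := Torus.divergence_eq_sum_partialDeriv_apply (hv.isContDiff (by simp)) x
    rw [← h2]
    exact hdiv x
  -- (iv) the vorticity
  set w : Fin 3 → ℝ := ![G 2 1 - G 1 2, G 0 2 - G 2 0, G 1 0 - G 0 1] with hw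
  have hvort : ∑ a, w a ^ 2 = torusVorticitySqAt v x := by
    rw [DoeringGibbon1995.sum_vort_sq G w hw, torusVorticitySqAt]
    congr 1
    simp only [hG, hR]
    simp_rw [hre]
    rw [Finset.sum_comm]
  -- (v) the gradient norm
  have hgrad : ∑ a, ∑ b, G a b ^ 2 = ∑ m, ‖R m‖ ^ 2 := by
    have h1 : ∀ m, ‖R m‖ ^ 2 = ∑ i, R m i ^ 2 := fun m => by
      rw [EuclideanSpace.norm_sq_eq]; simp [Real.norm_eq_abs, sq_abs]
    simp_rw [h1]
    simp only [hG]
    conv_rhs => rw [hre]; arg 2; ext a; rw [hre]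
    rw [Finset.sum_comm]
  have key := DoeringGibbon1995.cubeTrace_sub_stretchCubic_le G hM htr w hw (hvort ▸ hω)
  rw [hB, hC, ← hgrad]
  exact key

/-- **Discharge of `DoeringGibbon1995_enstrophyRate_le_vorticitySup`** (Doering–Gibbon 1995,
eq. (6.5.18): `dℰ/dt = ∫ω·(ω·∇)u - ν‖∇ω‖² ≤ ‖ω‖_∞‖ω‖₂² = 2‖ω‖_∞ℰ` on the periodic box).
PROVED along the module docstring: `H¹` balance, orthogonality form of the inertial term,
Betchov's `∫ tr (∇u)³ = 0`, the pointwise identity `tr G³ - tr GGᵀG = ωᵀSω` for trace-free `G`,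
Cauchy–Schwarz. [cite: DoeringGibbon1995, §6.5 eq. (6.5.18)] -/
theorem DoeringGibbon1995_enstrophyRate_le_vorticitySup_holds :
    DoeringGibbon1995_enstrophyRate_le_vorticitySup (d := d) := by
  intro hd ν hν a b hab u p hsol t ht M hM hω R hR
  have hut : Torus.IsSmooth (u t) := hsol.smooth_velocity.isSmooth_slice ht
  have hdivt : Torus.IsDivFree (u t) := hsol.divFree t ht
  have hD : ∀ m, Torus.IsSmooth (Torus.partialDeriv m (u t)) := fun m => hut.partialDeriv m
  have hDc : ∀ m j, Torus.IsSmooth (fun y => Torus.partialDeriv m (u t) y j) :=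
    fun m j => (hD m).apply j
  -- Step 1: identify `R` with the `H¹` balance rate
  have hbal := hsol.hasDerivWithinAt_half_gradNormSq hab ht
  have hU : UniqueDiffWithinAt ℝ (Icc a b) t := uniqueDiffOn_Icc hab t ht
  have hR' : HasDerivWithinAt (fun s => 2⁻¹ * Torus.gradNormSq (u s)) R (Icc a b) t := hR
  have hReq : R = -ν * (∫ x, ‖Torus.laplacian (u t) x‖ ^ 2) +
      ∫ x, ⟪Torus.convect (u t) (u t) x - (0 : ℝ → UnitAddTorus d → EuclideanSpace ℝ d) t x,
        Torus.laplacian (u t) x⟫_ℝ :=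
    (hR'.derivWithin hU).symm.trans (hbal.derivWithin hU)
  have hconv : ∫ x, ⟪Torus.convect (u t) (u t) x - (0 : ℝ → UnitAddTorus d → EuclideanSpace ℝ d) t x,
        Torus.laplacian (u t) x⟫_ℝ =
      ∫ x, ⟪Torus.laplacian (u t) x, Torus.convect (u t) (u t) x⟫_ℝ := by
    refine integral_congr_ae (Filter.Eventually.of_forall fun x => ?_)
    simp only [Pi.zero_apply, sub_zero]
    exact real_inner_comm _ _
  have hdiss : 0 ≤ ν * ∫ x, ‖Torus.laplacian (u t) x‖ ^ 2 :=
    mul_nonneg hν (integral_nonneg fun x => sq_nonneg _)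
  have hRle : R ≤ ∫ x, ⟪Torus.laplacian (u t) x, Torus.convect (u t) (u t) x⟫_ℝ := by
    rw [hReq, hconv]; linarith
  -- Step 2: orthogonality form and Betchov
  set B : UnitAddTorus d → ℝ := fun x => ∑ i, ∑ j, ∑ k, Torus.partialDeriv j (u t) x i *
    Torus.partialDeriv k (u t) x j * Torus.partialDeriv i (u t) x k with hB_def
  set C : UnitAddTorus d → ℝ := fun x => ∑ m, ∑ i, Torus.partialDeriv m (u t) x i *
    ⟪Torus.partialDeriv m (u t) x, Torus.partialDeriv i (u t) x⟫_ℝ with hC_def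
  have hBs : Torus.IsSmooth B := by
    have h : ∀ i j k, Torus.IsSmooth (fun x => Torus.partialDeriv j (u t) x i *
        Torus.partialDeriv k (u t) x j * Torus.partialDeriv i (u t) x k) :=
      fun i j k => ((hDc j i).mul (hDc k j)).mul (hDc i k)
    unfold Torus.IsSmooth at h ⊢
    exact ContDiff.sum fun i _ => ContDiff.sum fun j _ => ContDiff.sum fun k _ => h i j k
  have hCs : Torus.IsSmooth C := by
    have h : ∀ m i, Torus.IsSmooth (fun x => Torus.partialDeriv m (u t) x i *
        ⟪Torus.partialDeriv m (u t) x, Torus.partialDeriv i (u t) x⟫_ℝ) :=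
      fun m i => (hDc m i).mul ((hD m).inner (hD i))
    unfold Torus.IsSmooth at h ⊢
    exact ContDiff.sum fun m _ => ContDiff.sum fun i _ => h m i
  have horth : ∫ x, ⟪Torus.laplacian (u t) x, Torus.convect (u t) (u t) x⟫_ℝ = -∫ x, C x :=
    Torus.integral_inner_laplacian_convect_self_eq_neg hut hdivt
  have hBet : ∫ x, B x = 0 := integral_sum_partialDeriv_cube_eq_zero hut hdivt
  have hdiff : -∫ x, C x = ∫ x, (B x - C x) := by
    rw [integral_sub hBs.integrable hCs.integrable, hBet, zero_sub]
  -- Step 3: pointwise bound and integration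
  have hpt : ∀ x, B x - C x ≤ M * ∑ m, ‖Torus.partialDeriv m (u t) x‖ ^ 2 := fun x =>
    sum_partialDeriv_cube_sub_stretch_le hd hut hdivt hM x (hω x)
  have hGs : Integrable (fun x => M * ∑ m, ‖Torus.partialDeriv m (u t) x‖ ^ 2) :=
    (Torus.isSmooth_sum_norm_sq_partialDeriv hut).integrable.const_mul M
  have hmono : ∫ x, (B x - C x) ≤ ∫ x, M * ∑ m, ‖Torus.partialDeriv m (u t) x‖ ^ 2 :=
    integral_mono (hBs.integrable.sub hCs.integrable) hGs hpt
  have hgrad : ∫ x, M * ∑ m, ‖Torus.partialDeriv m (u t) x‖ ^ 2 = 2 * M * torusEnstrophy (u t) := by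
    rw [integral_const_mul, ← Torus.gradNormSq, gradNormSq_eq_two_mul_torusEnstrophy]; ring
  calc R ≤ ∫ x, ⟪Torus.laplacian (u t) x, Torus.convect (u t) (u t) x⟫_ℝ := hRle
    _ = ∫ x, (B x - C x) := by rw [horth, hdiff]
    _ ≤ ∫ x, M * ∑ m, ‖Torus.partialDeriv m (u t) x‖ ^ 2 := hmono
    _ = 2 * M * torusEnstrophy (u t) := hgrad

end Literature.Analysis.FluidPDE
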